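import Summits.QuantumFields.BalabanUV.T4Continuum.Support.SmallFieldDomainsCubes

/-!
# T⁴ programme, SUBSTRATE — `Support/SmallFieldDomainsCubesB9`: INTERIOR COVERINGS for the printed [B9] class of cubes
# (`IsClassCube396`, «O(1) ≧ 10» big blocks): (§1) the ELEVEN-block, block-centred odd enlargement of a point's big block ([B12]'s
# `□̃ⁿ` convention, CMP 109 p. 257) and (§2, v1.0.1) the TWELVE-block, vertex-centred cube of [B9] p. 408∕409 itself are class cubes of
# the point's index as soon as they fit in `Ω_j` ([Balaban1985BackgroundPropagators] p. 409: *"the number O(1) in the condition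
# (3.35) can be taken as equal to 12, thus the cube □̃⁵ is contained in one of the cubes for which this condition holds"*)
# (v1.0.1 after XREAD F-ne9leaf09g13-1: DOCFIX of the `□̃⁵` attribution + append-only §2 `interior_classCube396_vertex`)

Audit cell `pub-balaban`, SUBSTRATE cell seat p4; companion of `Support/SmallFieldDomainsCubes` v1.1 (`IsClassCube396`, p219149), same namespace.
After XREAD F-ne9leaf09g10-1 (the class has `≥ 10` blocks, so v1's one-block lemma was withdrawn) this file supplies replacements in the
INTERIOR regime; the collar regime (the cube pokes out of `Ω_j`; index `j − 1`, as in `collar_classCubeB11`) is NOT claimed here.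
TWO CONVENTIONS (v1.0.1, XREAD F-ne9leaf09g13-1): [B9] p. 408 Sect. C (render p020) defines, for a cube `□ ∈ 𝒟_j` that is a union of `2^d`
big blocks with centre at a VERTEX of the big-block lattice, *"□̃ⁿ as a cube of the size (2 + 2n)ML^jη, and with the same center as □,
hence it is a union of (2 + 2n)^d big blocks"* — so p. 409's `□̃⁵` is the EVEN, vertex-centred TWELVE-block cube (whence «equal to 12»;
`□̃⁴` = 10 blocks = p. 396's «≧ 10»); [Balaban1987RG1] p. 257 defines, for ONE block `□ ∈ π_j`, *"□̃ⁿ as a cube of the size (1 + 2n)M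
and with a center at the center of □"* — the ODD, block-centred convention.  §1's `enlCube a₀ s 5` is the LATTER (eleven blocks): an
admissible witness of the printed class (`ten_le` admits 11) but NOT p. 409's own cube; §2's `interior_classCube396_vertex` is the FORMER.

WHAT THIS FILE PROVIDES (all `[folklore]`):
 * §1 `enlCube a₀ s n` = the corner box of side `(2n+1)·s` about the side-`s` block with corner `a₀` ([B12]'s block-centred `□̃ⁿ`); the
   block of `x` and its enlargements contain `x` (`mem_enlCube_of_corner`); **`interior_classCube396`**: for `x ∈ Ω_j ∖ Ω_{j+1}` whose
   eleven-block enlargement lies in `Ω_j`, and `6 ≤ R·L`, it IS a printed-class cube of index `j` (`IsClassCube396 … j (corner − 5s) 11`) ∋ `x`;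
 * §2 (v1.0.1) `ccube_eq_cbox` and **`interior_classCube396_vertex`**: for a VERTEX `c` of the level-`j` big-block lattice with `x` in the
   `2^d`-block cube about `c`, `x ∈ Ω_j ∖ Ω_{j+1}`, the twelve-block cube `ccube c (6s) ⊆ Ω_j` and `7 ≤ R·L`, that cube — [B9] p. 408's
   `□̃⁵` — IS a printed-class cube of index `j` (`IsClassCube396 … j (c − 6s) 12`) ∋ `x`.
HONEST FRAMING (T4-DAG p. 1).  Set algebra on `ℤ^d`; no configuration, no estimate; nothing printed asserted.  NOT an estimate of any NE row;
spine 0/9 unchanged; NOT infinite volume, NOT a mass gap, NOT Clay.  HONEST DEPENDENCY: continuum YM on T⁴ ⇐ BetaPertH ∧ nine spine estimates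
(0/9 proved); BetaPertH ⇐ (D1) ∧ (D4) ∧ CAP+tail; G-an2-4 gates asym, D1 and NE2/3/4.  No `sorry`.
-/

noncomputable section

namespace Summit.QuantumFields.BalabanUV.T4Continuum.SmallFieldDomains

open Literature.MathematicalPhysics.QuantumFieldTheory.Balaban1983to89.B14DomainGeom

variable {d : ℕ}

/-- The `n`-fold ENLARGEMENT of the side-`s` block with lower corner `a₀`: the corner box of side `(2n+1)·s` with corner `a₀ − n·s`
(the block-centred `□̃ⁿ` of [Balaban1987RG1] p. 257, *"a cube of the size (1 + 2n)M and with a center at the center of □"*, for the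
big-block partition; NOT [B9] p. 408's vertex-centred `(2 + 2n)`-block `□̃ⁿ` — see §2). [folklore] -/
def enlCube (a₀ : Pt d) (s : ℤ) (n : ℕ) : Set (Pt d) := cbox (fun i => a₀ i - n * s) ((2 * n + 1) * s)

/-- A point with corner bounds `0 ≤ x_i − a₀_i < s` lies in every enlargement of its block. [folklore] -/
theorem mem_enlCube_of_corner {a₀ x : Pt d} {s : ℤ} (hs : 0 ≤ s) (hx : ∀ i, 0 ≤ x i - a₀ i ∧ x i - a₀ i < s) (n : ℕ) :
    x ∈ enlCube a₀ s n := by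
  intro i
  obtain ⟨h1, h2⟩ := hx i
  have hn : (0 : ℤ) ≤ n * s := mul_nonneg (Nat.cast_nonneg n) hs
  constructor
  · simp only; linarith
  · simp only; nlinarith

/-- Points of the `n`-fold enlargement are within `(n+1)·s` (sup) of any point of the central block. [folklore] -/
theorem within_of_mem_enlCube {a₀ x y : Pt d} {s : ℤ} (hx : ∀ i, 0 ≤ x i - a₀ i ∧ x i - a₀ i < s) {n : ℕ}
    (hy : y ∈ enlCube a₀ s n) : Within (((n : ℤ) + 1) * s) x y := by
  intro i
  obtain ⟨h1, h2⟩ := hx i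
  obtain ⟨h3, h4⟩ := hy i
  simp only at h3 h4
  rw [abs_le]
  constructor <;> nlinarith

/-- **AN INTERIOR COVERING FOR THE PRINTED [B9] CLASS, ELEVEN BLOCKS** (block-centred; v1.0.1: this is NOT p. 409's own `□̃⁵`, which
is the twelve-block cube of `interior_classCube396_vertex`): if `x ∈ Ω_j ∖ Ω_{j+1}` and the five-fold block-centred enlargement of `x`'s
`M₁L^j`-block (eleven blocks per side) lies in `Ω_j`, then — for `6 ≤ R·L` — it is an `IsClassCube396` cube of index `j` with eleven
blocks, and it contains `x`. [folklore] -/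
theorem interior_classCube396 {L M₁ R k : ℕ} {Ω : ℕ → Set (Pt d)} (hΩ : BigDomainSeq L M₁ R k Ω) (hL : 1 ≤ L) (hM₁ : 1 ≤ M₁)
    (hRL : 6 ≤ R * L) {j : ℕ} {x : Pt d} (hx : x ∈ layer Ω j)
    (hA : enlCube (corner (M₁ * L ^ j) x) ((M₁ * L ^ j : ℕ) : ℤ) 5 ⊆ Ω j) :
    IsClassCube396 L M₁ k Ω j (fun i => corner (M₁ * L ^ j) x i - 5 * ((M₁ * L ^ j : ℕ) : ℤ)) 11 ∧
      x ∈ enlCube (corner (M₁ * L ^ j) x) ((M₁ * L ^ j : ℕ) : ℤ) 5 := by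
  have hs : 0 < M₁ * L ^ j := Nat.mul_pos hM₁ (pow_pos hL j)
  set u : ℤ := ((M₁ * L ^ j : ℕ) : ℤ) with hu
  have hu0 : (0 : ℤ) ≤ u := by positivity
  have hxc : ∀ i, 0 ≤ x i - corner (M₁ * L ^ j) x i ∧ x i - corner (M₁ * L ^ j) x i < u := fun i => corner_le_lt _ hs x i
  have hxE : x ∈ enlCube (corner (M₁ * L ^ j) x) u 5 := mem_enlCube_of_corner hu0 hxc 5
  -- the enlargement IS the corner box of the statement
  have hbox : cbox (fun i => corner (M₁ * L ^ j) x i - 5 * u) ((11 * (M₁ * L ^ j) : ℕ) : ℤ) = enlCube (corner (M₁ * L ^ j) x) u 5 := by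
    unfold enlCube
    have e1 : (fun i => corner (M₁ * L ^ j) x i - 5 * u) = (fun i => corner (M₁ * L ^ j) x i - ((5 : ℕ) : ℤ) * u) := by
      funext i; push_cast; ring
    have e2 : ((11 * (M₁ * L ^ j) : ℕ) : ℤ) = (2 * ((5 : ℕ) : ℤ) + 1) * u := by rw [hu]; push_cast; ring
    rw [e1, e2]
  refine ⟨⟨hΩ.le_of_mem hx.1, by norm_num, fun i => ?_, ?_, ?_⟩, hxE⟩
  · -- corner on the big-block lattice
    exact dvd_sub (dvd_corner _ x i) (Dvd.intro_left _ rfl)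
  · -- `□̃⁵ ⊆ Ω_j ∖ Ω_{j+2}`
    rw [hbox]
    intro y hy
    refine ⟨hA hy, fun hy2 => hx.2 ?_⟩
    -- `y ∈ Ω_{j+2}` puts `x` (within `6u ≤ R·M₁·L^{j+1}` of `y`) into `Ω_{j+1}`
    refine hΩ.sep (j + 1) y hy2 x ?_
    have hw : Within ((5 + 1 : ℤ) * u) x y := by
      have := within_of_mem_enlCube hxc hy
      simpa using this
    refine hw.symm.mono ?_
    have h6 : (6 : ℤ) * u ≤ (R : ℤ) * M₁ * L ^ (j + 1) := by
      have h1 : ((6 : ℕ) : ℤ) * u ≤ ((R * L : ℕ) : ℤ) * u := mul_le_mul_of_nonneg_right (by exact_mod_cast hRL) hu0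
      have e : ((R * L : ℕ) : ℤ) * u = (R : ℤ) * M₁ * L ^ (j + 1) := by rw [hu]; push_cast; ring
      rw [e] at h1
      exact_mod_cast h1
    linarith
  · -- `□̃⁵` meets the layer `j`: it contains `x`
    rw [hbox]
    exact ⟨x, hxE, hx⟩


/-! ## §2 (v1.0.1, append-only) The vertex-centred twelve-block cube of [B9] p. 408∕409 -/

/-- A centred half-open cube is a corner box: `ccube c h = cbox (c − h) (2h)`. [folklore] -/
theorem ccube_eq_cbox (c : Pt d) (h : ℤ) : ccube c h = cbox (fun i => c i - h) (2 * h) := by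
  ext y
  simp only [mem_ccube, cbox, Set.mem_setOf_eq]
  refine forall_congr' fun i => ?_
  constructor <;> rintro ⟨h1, h2⟩ <;> exact ⟨by linarith, by linarith⟩

/-- **THE INTERIOR COVERING BY [B9]'S OWN `□̃⁵` (TWELVE BLOCKS, VERTEX-CENTRED)**: let `c` be a vertex of the level-`j` big-block lattice
(`M₁L^j ∣ c_i`) and `x ∈ Ω_j ∖ Ω_{j+1}` a point of the `2^d`-block cube `□` about `c` (`−s ≤ x_i − c_i < s`); if `□̃⁵ = ccube c (6s)`
(p. 408: *"a cube of the size (2 + 2n)ML^jη, and with the same center as □"*, `n = 5`) lies in `Ω_j` and `7 ≤ R·L`, then `□̃⁵` IS a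
printed-class cube of index `j` with twelve blocks (`IsClassCube396 … j (c − 6s) 12`), and `x ∈ □̃⁵`. [folklore] -/
theorem interior_classCube396_vertex {L M₁ R k : ℕ} {Ω : ℕ → Set (Pt d)} (hΩ : BigDomainSeq L M₁ R k Ω) (hL : 1 ≤ L)
    (hM₁ : 1 ≤ M₁) (hRL : 7 ≤ R * L) {j : ℕ} {x c : Pt d} (hc : ∀ i, ((M₁ * L ^ j : ℕ) : ℤ) ∣ c i) (hx : x ∈ layer Ω j)
    (hxc : ∀ i, -((M₁ * L ^ j : ℕ) : ℤ) ≤ x i - c i ∧ x i - c i < ((M₁ * L ^ j : ℕ) : ℤ))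
    (hA : ccube c (6 * ((M₁ * L ^ j : ℕ) : ℤ)) ⊆ Ω j) :
    IsClassCube396 L M₁ k Ω j (fun i => c i - 6 * ((M₁ * L ^ j : ℕ) : ℤ)) 12 ∧ x ∈ ccube c (6 * ((M₁ * L ^ j : ℕ) : ℤ)) := by
  have hs : 0 < M₁ * L ^ j := Nat.mul_pos hM₁ (pow_pos hL j)
  set u : ℤ := ((M₁ * L ^ j : ℕ) : ℤ) with hu
  have hu0 : (0 : ℤ) < u := by positivity
  have hxE : x ∈ ccube c (6 * u) := fun i => ⟨by linarith [(hxc i).1], by linarith [(hxc i).2]⟩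
  have hbox : cbox (fun i => c i - 6 * u) ((12 * (M₁ * L ^ j) : ℕ) : ℤ) = ccube c (6 * u) := by
    rw [ccube_eq_cbox]
    have e2 : ((12 * (M₁ * L ^ j) : ℕ) : ℤ) = 2 * (6 * u) := by rw [hu]; push_cast; ring
    rw [e2]
  refine ⟨⟨hΩ.le_of_mem hx.1, by norm_num, fun i => dvd_sub (hc i) (Dvd.intro_left _ rfl), ?_, ?_⟩, hxE⟩
  · rw [hbox]
    intro y hy
    refine ⟨hA hy, fun hy2 => hx.2 (hΩ.sep (j + 1) y hy2 x fun i => ?_)⟩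
    -- `|y_i − x_i| ≤ |y_i − c_i| + |c_i − x_i| ≤ 6u + u = 7u ≤ R·L·u = R·M₁·L^{j+1}`
    obtain ⟨h1, h2⟩ := hy i
    obtain ⟨h3, h4⟩ := hxc i
    have h7 : (7 : ℤ) * u ≤ (R : ℤ) * M₁ * L ^ (j + 1) := by
      have h1' : ((7 : ℕ) : ℤ) * u ≤ ((R * L : ℕ) : ℤ) * u := mul_le_mul_of_nonneg_right (by exact_mod_cast hRL) hu0.le
      have e : ((R * L : ℕ) : ℤ) * u = (R : ℤ) * M₁ * L ^ (j + 1) := by rw [hu]; push_cast; ring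
      rw [e] at h1'
      exact_mod_cast h1'
    rw [abs_le]
    constructor <;> linarith
  · rw [hbox]
    exact ⟨x, hxE, hx⟩

end Summit.QuantumFields.BalabanUV.T4Continuum.SmallFieldDomains
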